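import Literature.AlgebraicGeometry.Resolution.QuadraticTransforms
import HarnessLib

/-!
# Towers of quadratic transforms along a valuation collapse
# (crux `IndSmooth.ValuativeSmoothing`, line `birth`, stub `stub_sequenceCollapse`)

Stub `stub_sequenceCollapse` of the skeleton `Lines/birth.lean` (lead reshape r5, family 4:
"`O` dominates a two-dimensional regular local ring of `K`") for crux
stmt-ResolutionOfSingularities-16087. Along a sequence `R 0 → R 1 → ⋯` of quadratic transforms
ALONG the valuation ring `O` (`IsQuadraticTransformAlong O (R i) (R (i + 1))`: the local blowing
up of `R i` along its maximal ideal with respect to `O`) starting at the local ring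
`R 0 = B_𝔭 = locAtCentre B O` of a subring `B ⊆ O` at the centre of `O`, every member `R n` is
the local ring at the centre of `O` of a FINITELY GENERATED extension `B[t] ⊆ O`, `t ⊆ O` finite.

Proof (Novacoski–Spivakovsky, Lemma 2.9: local blowing ups compose): `R n` is a local blowing
up of `B` with respect to `O` (`IsLocalBlowup O B (R n)`), by induction on `n` — the trivial
local blowing up `B ↦ locAtCentre B O` (`IsLocalBlowup.locAtCentre_self`) for `n = 0`, and
`IsLocalBlowup.trans` with `(hstep n).isLocalBlowup` (`IsQuadraticTransformAlong.isLocalBlowup`)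
for `n + 1` — and a local blowing up of `B` is by definition `locAtCentre (B[t]) O` for a finite
`t ⊆ O`.
-/

-- single-problem summit: the doubled namespace component is forced
set_option linter.dupNamespace false

namespace Summit.ResolutionOfSingularities.ResolutionOfSingularities.Theorems.ValuativeSmoothing

open IsLocalRing Literature.AlgebraicGeometry.Resolution

/-- **Every member of a sequence of quadratic transforms along `O` starting at `B_𝔭` is a local
blowing up of `B` with respect to `O`**: induction on `n`, from the trivial local blowing up
`B ↦ locAtCentre B O` (`IsLocalBlowup.locAtCentre_self`) and composition of local blowing ups
(`IsLocalBlowup.trans`, Novacoski–Spivakovsky Lemma 2.9) with the step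
`IsQuadraticTransformAlong.isLocalBlowup`. [cite: NovacoskiSpivakovsky2014, Lemma 2.9] -/
theorem isLocalBlowup_of_quadraticSequence {K : Type} [Field K] (O : ValuationSubring K)
    (B : Subring K) (hB : B ≤ O.toSubring) (R : ℕ → Subring K) (h0 : R 0 = locAtCentre B O)
    (hstep : ∀ i, IsQuadraticTransformAlong O (R i) (R (i + 1))) (n : ℕ) :
    IsLocalBlowup O B (R n) := by
  induction n with
  | zero =>
    rw [h0]
    exact IsLocalBlowup.locAtCentre_self hB
  | succ n ih => exact ih.trans (hstep n).isLocalBlowup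

/-- **Stub `stub_sequenceCollapse` (line `birth`, crux `IndSmooth.ValuativeSmoothing`; r5-S2).**
Towers collapse: along a sequence of quadratic transforms along `O` starting at the local ring
`B_𝔭 = locAtCentre B O` of a subring `B ⊆ O` at the centre of `O`, every member is the local
ring at the centre of `O` of a finitely generated extension `B[t] ⊆ O`, `t ⊆ O` finite: it is a
local blowing up of `B` with respect to `O` (`isLocalBlowup_of_quadraticSequence`), which by
definition (`IsLocalBlowup`) has this shape. [cite: NovacoskiSpivakovsky2014, Lemma 2.9] -/
theorem stub_sequenceCollapse {K : Type} [Field K] (O : ValuationSubring K) (B : Subring K)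
    (hB : B ≤ O.toSubring) (R : ℕ → Subring K) (h0 : R 0 = locAtCentre B O)
    (hstep : ∀ i, IsQuadraticTransformAlong O (R i) (R (i + 1))) (n : ℕ) :
    ∃ t : Finset K, (↑t : Set K) ⊆ O ∧
      R n = locAtCentre (Subring.closure ((B : Set K) ∪ ↑t)) O :=
  (isLocalBlowup_of_quadraticSequence O B hB R h0 hstep n).2

end Summit.ResolutionOfSingularities.ResolutionOfSingularities.Theorems.ValuativeSmoothing
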